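import Summits.ValiantsHypothesis.ValiantsHypothesis.Theorems.LacunarySymmetroidMatrixDescartesFiniteSector
import Summits.ValiantsHypothesis.ValiantsHypothesis.Theorems.LacunarySymmetroidMatrixDescartesStampFull013578
import Summits.ValiantsHypothesis.ValiantsHypothesis.Theorems.LacunarySymmetroidMatrixDescartesStampFull01356
import Summits.ValiantsHypothesis.ValiantsHypothesis.Theorems.LacunarySymmetroidMatrixDescartesStampFull0134
import Summits.ValiantsHypothesis.ValiantsHypothesis.Theorems.LacunarySymmetroidMatrixDescartesStampFull013

/-!
# `MatrixDescartes` — lines «finite» / «stamp»: the G6 realisation DOUBLED — `η(2,6) ≥ 32`, i.e. `¬ HypRootLawAt 2 6 31` (by name)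

HONEST FRAMING.  Object-search cell `pub-symmetroid`, seat val-sym-door-p5 g7.  HELPER of the crux item `stmt-ValiantsHypothesis-18050`
(`Theses.LacunarySymmetroid.MatrixDescartes`) with NO closure claim.  Bookkeeping only: the PROVED doubling T2 of line «finite»
(`…FiniteSector.not_hypRootLawAt_of_fullPos`: a full-positive-rooted half-pencil of degree `n` doubles to an in-sector pencil of degree `2n`)
applied to val-sym-engine-7's kernel realisation of `G6` (`FiniteSector.fullyRealisable_two_dA5_16`, …StampFull013578, p609049:
`ν(2,6) = 16 = n(2,5)` on `dA5 = (0,1,3,5,7,8)`) gives the sector row `η(2,6) ≥ 32` as a NAMED theorem, superseding by name the tree's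
`not_hypRootLawAt_two_six_27` (…FiniteSectorCertificates, doubled engine-5 record, `η(2,6) ≥ 28`).  The general adapter
`not_hypRootLawAt_of_fullyRealisable` (`FullyRealisable m d n ⇒ ¬ HypRootLawAt m K B` for `B < 2n`) is stated once for every future stamp row
(`G7`/`G8`/`G9` would read `η(2,7) ≥ 40`, `η(2,8) ≥ 52`, `η(2,9) ≥ 64` the same way).  Desk pub-symmetroid R2477 (A) issued the reading
«η(2,6) ≥ 32 by kernel doubling»; this file is that reading by name.  Nothing here bears on the crux (asymptotic), on `H3`, on the doors, or on `VP ≠ VNP`.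
[folklore] Elementary bookkeeping (`X ↦ X²` doubling); no citation is load-bearing.
-/

-- `Summit.ValiantsHypothesis.ValiantsHypothesis.…` repeats a component by the D-0017 layout
-- (single-conjunct summit), which the `dupNamespace` linter flags; the name is mandated.
set_option linter.dupNamespace false

namespace Summit.ValiantsHypothesis.ValiantsHypothesis.Theorems.LacunarySymmetroidMatrixDescartes.FiniteSector

open scoped BigOperators Matrix
open Polynomial

/-- **Stamp realisation ⇒ sector row by doubling.**  If some symmetric `(m,K)` half-pencil on `d` is full-positive-rooted of degree exactly `n`
(`FullyRealisable m d n`), then no sector bound `η(m,K) ≤ B` with `B < 2n` holds: `¬ HypRootLawAt m K B` (T2 `not_hypRootLawAt_of_fullPos`). [folklore] -/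
theorem not_hypRootLawAt_of_fullyRealisable {m K n B : ℕ} {d : Fin K → ℕ} (h : FullyRealisable m d n) (hB : B < 2 * n) :
    ¬ HypRootLawAt m K B := by
  obtain ⟨S, hS, hfull, hdeg⟩ := h
  have hdeg' : (Matrix.det (∑ l, ((Polynomial.X : ℝ[X]) ^ d l) • (S l).map Polynomial.C)).natDegree = n := hdeg
  exact not_hypRootLawAt_of_fullPos d S hS hfull (by omega)

/-- **`η(2,6) ≥ 32`**: `¬ HypRootLawAt 2 6 31` — the doubled `G6` realisation (`fullyRealisable_two_dA5_16`, val-sym-engine-7): an in-sector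
(all roots real and simple) symmetric `(2,6)` pencil on `(0,2,6,10,14,16)` of degree `32`.  Supersedes `not_hypRootLawAt_two_six_27` by name. [folklore] -/
theorem not_hypRootLawAt_two_six_31 : ¬ HypRootLawAt 2 6 31 :=
  not_hypRootLawAt_of_fullyRealisable fullyRealisable_two_dA5_16 (by norm_num)

/-- The same row UNFOLDED (citable without `…FiniteSectorDefs`): no bound `31` on the degree of an in-sector (`#distinct real roots = natDegree`)
determinant of a real symmetric `(2,6)` lacunary pencil. [folklore] -/
theorem not_hypRootLawAt_two_six_31' :
    ¬ (∀ (d : Fin 6 → ℕ) (S : Fin 6 → Matrix (Fin 2) (Fin 2) ℝ), (∀ l, (S l).IsSymm) →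
        (Matrix.det (∑ l, ((Polynomial.X : Polynomial ℝ) ^ d l) • (S l).map Polynomial.C)
            ).roots.toFinset.card =
          (Matrix.det (∑ l, ((Polynomial.X : Polynomial ℝ) ^ d l) • (S l).map Polynomial.C)).natDegree →
        (Matrix.det (∑ l, ((Polynomial.X : Polynomial ℝ) ^ d l) • (S l).map Polynomial.C)).natDegree
          ≤ 31) :=
  fun h => not_hypRootLawAt_two_six_31 h

/-- The four `m = 2` stamp rows doubled, in one line: `η(2,3) ≥ 8`, `η(2,4) ≥ 16`, `η(2,5) ≥ 24`, `η(2,6) ≥ 32` (from `fullyRealisable_two_013_4`,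
`_0134_8`, `_01356_12`, `_dA5_16`). [folklore] -/
theorem eta_two_row_lower :
    ¬ HypRootLawAt 2 3 7 ∧ ¬ HypRootLawAt 2 4 15 ∧ ¬ HypRootLawAt 2 5 23 ∧ ¬ HypRootLawAt 2 6 31 :=
  ⟨not_hypRootLawAt_of_fullyRealisable fullyRealisable_two_013_4 (by norm_num),
   not_hypRootLawAt_of_fullyRealisable fullyRealisable_two_0134_8 (by norm_num),
   not_hypRootLawAt_of_fullyRealisable fullyRealisable_two_01356_12 (by norm_num),
   not_hypRootLawAt_two_six_31⟩

end Summit.ValiantsHypothesis.ValiantsHypothesis.Theorems.LacunarySymmetroidMatrixDescartes.FiniteSector
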